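import Summits.QuantumFields.YangMills.Theorems.BalabanUVNodesK0RecordFormatNamesLemmas2
import Summits.QuantumFields.YangMills.Theorems.BalabanUVNodesN09FlatSectorUniqueness
import Summits.QuantumFields.YangMills.Theorems.BalabanUVNodesN09UkSelAtJunction

/-!
# PORT PT-B (U8), file 1 — the ι-ROW AT ITS VALUE: `recordEmbJ F θ k K 0 = 0` (the second conjunct of `IotaRowAtJ`), from `UkSel … 1 = 1`

Cell `ym-nodeO-ideate` ∕ programme cell `ym-balaban-port`, porter seat `ymgap-nodeO-port-PTB-1` (gen 0) on item **stmt-QuantumFields-27931**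
`BalabanUVNodes.PortPieceLocalityU8` (string of record ⁶ = `nodeO-cover/TYPER-Sig27931-v6-J.txt`, sha16 `3e2971674efa3b12`);
`--kind proof --supports stmt-QuantumFields-27931` (helper; the row's FIRST conjunct `ContDiffAt ℝ 2 (recordEmbJ …) 0` is [15] Prop. 9 content and is NOT here).
[I] = [Balaban1987RG1], [15] = [Balaban1985Variational].  CONSUMED BY NAME, nothing re-declared: DEF-1's names module ed.7∕8
(`unitField ∕ recordBgField ∕ recordEmb ∕ recordEmbJ ∕ recordBgUnits ∕ recordCurrent ∕ sl2Coord ∕ thetaFill ∕ recordK₀`), dag-n09-w4's `UkSel` offer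
(`rootGauge_eq_UkSel_of_isBackground`, `rootGauge_one`), dag-n09-w1's flat-sector rigidity (`N09FlatSectorUniqueness.uniqueUkOrbit_one`) and non-vacuity
(`N09UkSelAtJunction.isBackground_one_one`), the tree's `MatrixLog.mlog_one`, `B9Eq37Insertion.imC_one`, `B9Eq39Adjoint.covDstar_zero`.

WHAT THIS FILE PROVES (theorems only; no `def`, no `instance`, no `notation`, no `sorry`; standard axioms).
* §1 `UkSel_unit` — **`U_k(1) = 1` IN THE ROOTED GAUGE**: over the unit coarse field the offer `UkSel F N K k ε` returns the unit fine field (standing range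
  `k ≤ m + K`, `0 < ε`): [15] Thm 1's uniqueness clause HOLDS on the flat sector (rigidity, kernel theorem of the tree), `1` is a minimiser over `1`, and the
  offer is canonical there (`rootGauge 1 = 1`).  CRIT-1 l.3682's «`Uk_one`-type lemma».
* §2 the unit field at `B = 0`: `unitField_zero` (`W_0 = exp(ρ₈ 0) = 1`), `recordBgField_zero` (`U_{k+1}(W_0) = 1` in the rooted gauge), `recordBgUnits_zero`.
* §3 the current of the unit configuration vanishes: `imPlaq_one`, `current_one` ((1.8) at `𝐔 ≡ 1`: `Im ∂1 = 0`), `recordCurrent_zero`.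
* §4 ★ `recordEmb_zero` ∕ ★ `recordEmbJ_zero` — the coordinate embeddings VANISH AT `B = 0` (`log 1 = 0`, `J(1) = 0`, `sl2Coord 0 = 0`); ★ `recordEmbJ_zero_thetaFill` —
  the port text's instance: at `θ := thetaFill F a₀ ε₂₉` (`εbg = a₀ > 0`) and the volumes `recordK₀ F Mc k + n` the second conjunct of 27931⁶'s ι-row holds for
  every `k`, `n`.

HONEST FRAMING.  The VALUE of the embedding at the origin, from the flat-sector rigidity already in the tree; NOTHING of Bałaban's analysis ([15] Thm 1 off the
flat sector, Prop. 9, (190), the `C²`∕analytic dependence of `U_k(V)` on `V`) is asserted, ported or discharged; the ι-row's first conjunct and rows (R1ᴰ)∕(R4ᴰ)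
of `Response9D` remain OPEN content; 27931⁶ OPEN; K0⁷ NOT closed; NODE O 0∕1; COUNT 8∕28 · K 1∕4 UNMOVED; finite `𝕋⁴_{L^K}` at fixed ε — NOT continuum ∕ OS ∕
Clay; **the Yang–Mills mass gap (Clay) is NOT proved by any of this.**
-/

noncomputable section

open scoped BigOperators Matrix.Norms.L2Operator

namespace Summit.QuantumFields.YangMills.Theorems.PortU8

open Literature.MathematicalPhysics.QuantumFieldTheory.Balaban1983to89
open Literature.MathematicalPhysics.QuantumFieldTheory.Balaban1983to89.Node00
open Literature.MathematicalPhysics.QuantumFieldTheory.Balaban1983to89.T4Continuum (T4Family)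
open Literature.MathematicalPhysics.QuantumFieldTheory.Balaban1983to89.T4RootedResidualGauge (rootGauge rootGauge_one)
open Summit.QuantumFields.YangMills.Theorems.K0RecordFormatNames
open Summit.QuantumFields.YangMills.BalabanUVNodes.N09FlatSectorUniqueness (uniqueUkOrbit_one)
open Summit.QuantumFields.YangMills.BalabanUVNodes.N09UkSelAtJunction (isBackground_one_one)
open NormedSpace (exp)

/-! ## §1  `U_k(1) = 1` in the rooted gauge -/

/-- **`UkSel F N K k ε 1 = 1`**: over the UNIT coarse field the rooted-gauge minimiser of record is the unit fine field (standing range `k ≤ m + K`, radius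
`ε > 0`) — the (0.21) problem is rigid on the flat sector (`uniqueUkOrbit_one`), `1` is a minimiser over `1` (`isBackground_one_one`), the offer is the rooted
gauge of ANY minimiser under uniqueness (`rootGauge_eq_UkSel_of_isBackground`), and `rootGauge 1 = 1`. [cite: Balaban1987RG1, (0.21) p.256, (2.3) p.265; Balaban1985Variational, Thm 1 p.279 (flat case)] -/
theorem UkSel_unit {F : T4Family} {N : ℕ} [NeZero N] {K k : ℕ} (hk : k ≤ (F.P K).m + (F.P K).K) {ε : ℝ} (hε : 0 < ε) :
    UkSel F N K k ε (1 : GaugeField (F.P K) k (SU N)) = 1 :=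
  (rootGauge_eq_UkSel_of_isBackground hk (uniqueUkOrbit_one (F := F) (N := N) hk ε) (isBackground_one_one (F := F) (N := N) K k hε)).symm.trans
    (rootGauge_one k)

variable (F : T4Family) (θ : Stage13Params F 2)

/-! ## §2  The unit-lattice field, the background field and its units at `B = 0` -/

/-- `W_0 = 1`: the configuration charted by `B = 0` is the unit field (`exp(ρ₈ 0) = exp 0 = 1`, read through `suOfMat`). [cite: Balaban1987RG1, p.264 (before (1.20))] -/
theorem unitField_zero (k K : ℕ) :
    (letI := θ.instVβ₁; letI := θ.instVβ₂; unitField F θ k K 0) = 1 := by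
  letI := θ.instVβ₁; letI := θ.instVβ₂
  funext b
  show suOfMat 2 (exp (θ.ρ8 ((0 : Fin (F.P K).d → Site (F.P K) (k + 1) → θ.Vβ) b.dir b.src))) = 1
  rw [Pi.zero_apply, Pi.zero_apply, map_zero, NormedSpace.exp_zero]
  exact suOfMat_coe (1 : SU 2)

/-- **`U_{k+1}(W_0) = 1` in the rooted gauge** (standing range `k + 1 ≤ m + K`, `0 < θ.εbg`). [cite: Balaban1987RG1, (0.21) p.256, (2.3) p.265] -/
theorem recordBgField_zero (k K : ℕ) (hk : k + 1 ≤ (F.P K).m + (F.P K).K) (hε : 0 < θ.εbg) :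
    (letI := θ.instVβ₁; letI := θ.instVβ₂; recordBgField F θ k K 0) = 1 := by
  letI := θ.instVβ₁; letI := θ.instVβ₂
  show UkSel F 2 K (k + 1) θ.εbg (unitField F θ k K 0) = 1
  rw [unitField_zero]
  exact UkSel_unit hk hε

/-- The units-valued background field at `B = 0` is the unit configuration. [cite: Balaban1987RG1, (1.8)–(1.9) p.261 (bookkeeping)] -/
theorem recordBgUnits_zero (k K : ℕ) (hk : k + 1 ≤ (F.P K).m + (F.P K).K) (hε : 0 < θ.εbg) :
    (letI := θ.instVβ₁; letI := θ.instVβ₂; recordBgUnits F θ k K 0) = 1 := by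
  letI := θ.instVβ₁; letI := θ.instVβ₂
  funext b
  show ιSU 2 (recordBgField F θ k K 0 b) = 1
  rw [recordBgField_zero F θ k K hk hε]
  show ιSU 2 1 = 1
  exact map_one _

/-! ## §3  The current (1.8) of the unit configuration vanishes -/

section CurrentOne

variable {P : Params} {i : ℕ} {𝔸 : Type*} [Ring 𝔸] [Algebra ℂ 𝔸]

/-- `ξ⁻² π Im ∂1 = 0`: every plaquette variable of the unit configuration is `1` and `Im 1 = 0`. [cite: Balaban1987RG1, (1.8) p.261] -/
theorem imPlaq_one (π : 𝔸 →ₗ[ℂ] 𝔸) (ξ : ℝ) : B12Eq18Current.imPlaq π ξ (1 : PBond P i → 𝔸ˣ) = 0 := by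
  funext μ ν x
  simp [B12Eq18Current.imPlaq, B9Eq39Adjoint.plaqU, B12Eq18Current.dirForm]

/-- **`J(1) = 0`**: the current (1.8) of the unit configuration vanishes (`D^{ξ*}` of the zero plaquette function). [cite: Balaban1987RG1, (1.8) p.261] -/
theorem current_one (π : 𝔸 →ₗ[ℂ] 𝔸) (ξ : ℝ) : B12Eq18Current.current π ξ (1 : PBond P i → 𝔸ˣ) = 0 := by
  funext b
  rw [B12Eq18Current.current_apply, imPlaq_one]
  simp [B9Eq39Adjoint.divP]

end CurrentOne

/-- `J_{k+1}(W_0) = 0`: the record's current at `B = 0`. [cite: Balaban1987RG1, (1.8) p.261] -/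
theorem recordCurrent_zero (k K : ℕ) (hk : k + 1 ≤ (F.P K).m + (F.P K).K) (hε : 0 < θ.εbg) :
    (letI := θ.instVβ₁; letI := θ.instVβ₂; recordCurrent F θ k K 0) = 0 := by
  letI := θ.instVβ₁; letI := θ.instVβ₂
  show B12Eq18Current.current sl2Proj ((F.P K).eta (k + 1)) (recordBgUnits F θ k K 0) = 0
  rw [recordBgUnits_zero F θ k K hk hε]
  exact current_one _ _

/-! ## §4  The coordinate embeddings vanish at `B = 0` -/

/-- `sl2Coord 0 = 0`. [cite: Balaban1987RG1, (1.10) p.262 (bookkeeping)] -/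
theorem sl2Coord_zero : sl2Coord 0 = 0 := by
  ext a
  fin_cases a <;> simp [sl2Coord]

/-- ★ **`ι(0) = 0` (one-block)**: `recordEmb F θ k K 0 = 0` — the 𝔰𝔩₂-coordinates of `log U_{k+1}(W_0) = log 1 = 0`. [cite: Balaban1987RG1, (4.35) p.290, p.258] -/
theorem recordEmb_zero (k K : ℕ) (hk : k + 1 ≤ (F.P K).m + (F.P K).K) (hε : 0 < θ.εbg) :
    (letI := θ.instVβ₁; letI := θ.instVβ₂; recordEmb F θ k K 0) = 0 := by
  letI := θ.instVβ₁; letI := θ.instVβ₂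
  have hbg := recordBgField_zero F θ k K hk hε
  funext i
  show sl2Coord (MatrixLog.mlog ((recordBgField F θ k K 0 ((chartEquiv F K).symm i).1 : SU 2) : MatA 2)) ((chartEquiv F K).symm i).2 = 0
  rw [hbg]
  show sl2Coord (MatrixLog.mlog ((1 : SU 2) : MatA 2)) ((chartEquiv F K).symm i).2 = (0 : Fin 3 → ℂ) ((chartEquiv F K).symm i).2
  have h1 : ((1 : SU 2) : MatA 2) = 1 := rfl
  rw [h1, MatrixLog.mlog_one, sl2Coord_zero]

/-- ★ **`ι(0) = 0` (two-block) — the SECOND CONJUNCT of 27931⁶'s ι-row `IotaRowAtJ`**: `recordEmbJ F θ k K 0 = 0` — both the `log 𝐔`-block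
(`log 1 = 0`) and the `𝐉`-block (`J(1) = 0`) vanish at the origin. [cite: Balaban1987RG1, (1.8)–(1.9) p.261, (4.35) p.290] -/
theorem recordEmbJ_zero (k K : ℕ) (hk : k + 1 ≤ (F.P K).m + (F.P K).K) (hε : 0 < θ.εbg) :
    (letI := θ.instVβ₁; letI := θ.instVβ₂; recordEmbJ F θ k K 0) = 0 := by
  letI := θ.instVβ₁; letI := θ.instVβ₂
  have hbg := recordBgField_zero F θ k K hk hε
  have hcur := recordCurrent_zero F θ k K hk hε
  funext i
  show Sum.elim (fun a => sl2Coord (MatrixLog.mlog ((recordBgField F θ k K 0 ((chartEquivJ F K).symm i).1 : SU 2) : MatA 2)) a)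
      (fun a => sl2Coord (recordCurrent F θ k K 0 ((chartEquivJ F K).symm i).1) a) ((chartEquivJ F K).symm i).2 = 0
  rw [hbg, hcur]
  show Sum.elim (fun a => sl2Coord (MatrixLog.mlog ((1 : SU 2) : MatA 2)) a) (fun a => sl2Coord (0 : MatA 2) a) ((chartEquivJ F K).symm i).2 = 0
  have h1 : ((1 : SU 2) : MatA 2) = 1 := rfl
  rw [h1, MatrixLog.mlog_one, sl2Coord_zero]
  cases ((chartEquivJ F K).symm i).2 <;> rfl

/-- ★ **THE PORT TEXT's INSTANCE** — the second conjunct of 27931⁶'s ι-row at `θ := thetaFill F a₀ ε₂₉` (whose background radius IS `a₀`,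
`theta13OfThm1CCMWZB_εbg`) and the volumes `K := recordK₀ F Mc k + n` (so `k + 1 ≤ K ≤ m + K`): for `0 < a₀`, every `k`, `n`,
`recordEmbJ F (thetaFill F a₀ ε₂₉) k (recordK₀ F Mc k + n) 0 = 0`. [cite: Balaban1987RG1, (4.35) p.290, (1.9) p.261, (1.21) p.264] -/
theorem recordEmbJ_zero_thetaFill (a₀ ε₂₉ : ℝ) (ha₀ : 0 < a₀) (Mc k n : ℕ) :
    letI θ := thetaFill F a₀ ε₂₉; letI := θ.instVβ₁; letI := θ.instVβ₂;
    recordEmbJ F θ k (recordK₀ F Mc k + n) 0 = 0 := by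
  refine recordEmbJ_zero F (thetaFill F a₀ ε₂₉) k (recordK₀ F Mc k + n) ?_ ?_
  · simp only [T4Family.P_m, T4Family.P_K, recordK₀]
    omega
  · show 0 < a₀
    exact ha₀

end Summit.QuantumFields.YangMills.Theorems.PortU8

end
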